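import Mathlib
import HarnessLib
import HarnessLib.Audit
import Summits.QuantumAdvantage.Statement
import Literature.Computability.Complexity.Promise
import Literature.Computability.Cryptography.ClassBQP
import Literature.Computability.Complexity.BoolEncodings
import Literature.Computability.Complexity.PromiseBPPClosureProofs
import Literature.Computability.Complexity.PromiseZPPProofs
import HarnessLib.Audit.Status.Attr

/-!
Route: TwoAdicStationaryPhase

DORMANT since 2026-08-23T05:12:02Z (reconciler: no traction for 5.9 d (last activity statement-grounded at 2026-08-17T06:24:47Z); parked, not closed — `ledger route dormant route-QuantumAdvantage-TwoAdicStationaryPhase --off` to reactiv) — unstaffed, not closed; items shared with open routes are served there. `ledger route dormant <id> --off` reactivates.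

# Route QuantumAdvantage/TwoAdicStationaryPhase — stationary phase is EXACT on ℤ/4^c registers, so
polynomial quantum maps dequantize (¬S-side island route; realises idea card
two-adic-stationary-phase-henon and resolves its fork C4 toward the island)

## Thesis X (targets ¬Statement; the target decl is shared with route Dequantize)
Words: every language decided by a poly-time uniform Clifford+T family is in BPP.
Lean: `Literature.Computability.Cryptography.BQP ⊆ Literature.Computability.Complexity.BPP`.

X is reached as ISLAND ∧ HARDNESS at the promise level, for the promise problem POLYSIGN: input (c
in unary, x, y ∈ ℕ, kick polynomials P_0..P_k ∈ ℤ[t] as coefficient lists); A := ⟨y| F·D_{P_k} ⋯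
F·D_{P_0} |x⟩ on ONE register ℤ/4^c, F = QFT_{4^c}, D_P|t⟩ = e(P(t)/4^c)|t⟩; YES if Re A ≥ 1/3, NO
if Re A ≤ −1/3. Path sum: A = 2^{-c(k+1)} Σ_{v∈(ℤ/4^c)^k} e(Φ(v)/4^c), Φ = Σ_{i=0}^{k} P_i(w_i) +
w_i w_{i+1}, w = (x, v_1..v_k, y).
* ISLAND (crux TspSignInPrBPP, expected TRUE — the route's earned theorem): POLYSIGN ∈ PromiseBPP'.
Mechanism: (E) exact 2-adic stationary phase Σ_v e(Φ(v)/4^c) = 2^{ck} Σ_{a∈(ℤ/2^c)^k, ∇Φ(a)≡0 mod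
2^c} e(Φ(ã)/4^c) (support TspChainLocalisation; Dąbrowski–Fisher 1997 / Fisher 2002 / Kocia–Love Thm
1, specialised to p = 2, exponent 2c); (T) the critical points are the 2-adic Hénon-skeleton
trajectories a_{j+1} = −a_{j−1} − P'_{j}(a_j), determined by a_1 (support TspChainInjective); hence
(crux TspAmplitudeAverage) A = 2^{-c} Σ_{a critical} e(Φ(ã)/4^c) with ≤ 2^c critical points: EVERY
amplitude is an exact average over s ∈ ℤ/2^c of a poly-time computable term in {0} ∪ U(1), and O(1)
Monte-Carlo samples decide the promise (Hoeffding).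
* HARDNESS (crux TspSignHard, hypothesis-type, the first horn of the card's fork C4): every
PromiseBQP problem Karp-reduces to POLYSIGN. Given the island it is FALSE unless PromiseBQP ⊆ prBPP;
it stays in the assembly as the explicit load-bearing hypothesis (shape of route Dequantize). Its
expected failure is the informative output: QFT_{2^n} + arbitrary integer-polynomial phase kicks
(any degree, any number of kicks, conjecturally any number r of registers: crux TspMultiRegister) at
2-adic precision n ≥ 2 form a classically DECIDABLE sub-model of BQP although they carry linear
'T-like' magic, volume-law entanglement and linear treewidth — a new island, incomparable with
normalizer/stabilizer-rank (Vandennest2013), matchgate, tensor-network and p-blocked (Jozsa–Linden)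
islands; n = 1 (qubits, H + CCZ) is universal, so one extra 2-adic digit per Fourier variable is
exactly where interference stops paying.

## Assembly
`TspSignInPrBPP → TspSignHard → ¬ QuantumAdvantage`: hardness + closure of prBPP under Karp
reductions (tree theorem `mem_PromiseBPP'_of_polyTimeReducible_holds`) give PromiseBQP ⊆
PromiseBPP'; for L ∈ BQP, `ofLanguage L ∈ PromiseBQP` (`ofLanguage_mem_PromiseBQP_iff`) hence `∈
PromiseBPP'`, hence L ∈ BPP (`ofLanguage_mem_PromiseBPP'_iff`); contradiction with the summit
witness. ≤ 10 lines.

Rationale: WHY THIS LINE. The card proposed to dequantize 'polynomial quantum maps' (QFT_{2^n} + kicks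
e(P(x)/2^n) on few big registers — the kicked-rotor/Hénon maps of quantum-chaos computing) by 2-adic
stationary phase, which is EXACT mod 2^n (no ħ-expansion: Dąbrowski–Fisher/Fisher, used for odd p by
KociaLove2021), and to fork on C4: 'quantum Hénon amplitudes are PromiseBQP-hard OR the model is a
new island'. Planner analysis + numerics (NOTES.md; scratch/check_*.py: 0 failures on ~10^3
brute-forced amplitudes, 1–3 registers, degree ≤ 5, n = 2..6) RESOLVE the fork: for even n = 2c the
localised sum is an exact AVERAGE of ≤ 2^{c r} unimodular terms indexed by the first path variable
of each register, so every amplitude is BPP-estimable to ±1/poly and C4's first horn dies unless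
PromiseBQP ⊆ prBPP. What survives is a genuinely new ISLAND theorem (import: p-adic exponential sums
/ arithmetic dynamics — the critical points ARE the Hénon-skeleton trajectories of the card), filed
¬S-side in the shape of Dequantize: X = BQP ⊆ BPP from ISLAND (provable) ∧ HARDNESS (hypothesis, now
believed false). Earned content = the island; the route calibrates WHERE interference stops paying
(n = 1 universal vs n ≥ 2 classical for ring-polynomial phases) and kills a natural-looking hardness
candidate (quantum kicked polynomial maps, cf. Georgeot–Shepelyansky-type proposals).
RANKED CRUXES. (2) TspSignInPrBPP — POLYSIGN ∈ prBPP (island; Monte Carlo over the initial momentum;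
c unary). (3) TspAmplitudeAverage — A = 2^{-c}·Σ_{critical a} e(Φ(ã)/4^c) and #critical ≤ 2^c (the
load-bearing identity; pure Mathlib). (4) TspSignHard — PromiseBQP ≤_Karp POLYSIGN (hypothesis-type;
refuters: expect suspect-false; do not staff provers). (5) TspOddGaussBound — odd modulus 2·4^c: the
𝔽₂ Hessian–Gauss factor G(ã) = Σ_{u∈{0,1}^k} e((Φ(ã+2^c u)−Φ(ã))/2^{2c+1}) has |G| ≤ 2^{(k+1)/2}
(needed for the model at odd n; one register: alternating part of the Hessian mod 2 = path
adjacency, corank ≤ 1). (6) TspMultiRegister (informal until def PolyPhaseCircuit lands) — r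
registers with cross-register kicks: A = 2^{-c r'}Σ_{Crit} e(Φ/4^c), Crit ↪ (ℤ/2^c)^{r'} via first
variables (triangularity of the critical system in creation order).
SUPPORT. TspChainLocalisation (= Fisher's theorem at p = 2, m = 2c, chain case), TspChainInjective
(recurrence), TspOddModulus (odd-exponent localisation with G), TspDecisionInBPP (informal
corollary: uniform families of such circuits with low-bit readout decide only BPP languages; bias =
one amplitude of C†·D_{2^{2c−1}t}·C).
KILL CRITERIA. TspAmplitudeAverage refuted (a brute-force counterexample at small c,k) kills the
island and reopens the card's fork as filed (then restate C4/T3 per the card). TspSignHard PROVED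
would give ¬QuantumAdvantage outright (not expected). TspSignHard refuted STRUCTURALLY (e.g. an
invariant showing one-register words cannot implement a bare Hadamard on a sub-qubit, or that
r-register polynomial-phase circuits over ℤ/4 are not encoded-universal) closes the route
'exhausted' with the island proved and recorded as negative knowledge for S-side searches; a merely
conditional refutation (¬Hard ⇐ PromiseBQP ⊄ prBPP) is expected and is not a kill of the island
items.
NOT DECOMPOSED YET. The r-register syntax/semantics (definition request PolyPhaseCircuit); odd n for
r ≥ 2 (Hessian corank vs r'); affine/automorphism gates x ↦ ax+b and cross-register shears (compile
as F†·kick·F); SAMPLING hardness of the ℤ/4 model (amplitudes include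
2^{-r}Σ_{a∈𝔽₂^r}(−1)^{cubic(a)}: IQP sums with classical normalisation — exact sampling may still be
PH-hard; irrelevant to S, deliberately unfiled); Shor's modular exponentiation and sub-register QFTs
are NOT model gates (they make Φ non-polynomial resp. even, killing the constraint) — the precise
boundary is left to tenure.
SOURCES. Vandennest2013 (normalizer circuits = quadratic case, Thm 1), KociaLove2021 (§5 Thm 1 =
Fisher's periodized stationary phase; odd p, strong simulation, 3^{t+1} terms), Fisher2002,
DabrowskiFisher1997, CaiEtAl2010 + BuKoh2022 (exact evaluation: quadratic in P, cubic #P-hard —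
consistent: we only estimate additively), Vandennest2011 (probabilistic simulation by bounded
estimators), GoldreichPromise2006/Watrous2009 (promise classes), Hoeffding1963, AroraBarakCC2009 §7.

Novelty: NOVELTY (searched 2026-08-15: `lit read arxiv:1201.4867` Thm 1 p.7 + p.8 (cyclic ℤ_{2^m} remark),
`lit read arxiv:1810.03622` §5 (Thm 1 = Fisher's periodized stationary phase over (ℤ/p^m)^n, p odd;
p.17: 3^{t+1} critical terms for qutrit π/8 circuits; p.30: enlarging ℤ/3 to ℤ/9 to make the phase
integral), crossref for Fisher2002 (doi:10.1006/jnth.2002.2790) and DabrowskiFisher1997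
(doi:10.4064/aa-80-1-1-48), Vandennest2013 (doi:10.26421/qic13.11-12-7), BuKoh2022
(doi:10.1007/s00220-022-04320-1), CaiEtAl2010 (doi:10.1007/978-3-642-14553-7_16); `lit vsearch` of
the island statement (no hit); arXiv/OpenAlex/S2 rate-limited; the card's own searches of
arXiv:1005.2632, 1812.00224, quant-ph/0010005, chao-dyn/9805006). Nearest prior art: (1)
Vandennest2013 Thm 1: QFT + automorphism + QUADRATIC phase gates over any finite abelian group
(normalizer circuits) are classically samplable — the degree-2 case of our model, by a
stabilizer-type formalism; (2) KociaLove2021: the same exact localisation lemma (Fisher) used as a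
STRONG-simulation device for odd-prime(-power) qudits, cost = number of critical points, exponential
in the magic count; (3) DabrowskiFisher1997/Fisher2002: the number-theoretic identity itself; (4)
CaiEtAl2010/BuKoh2022: EXACT evaluation of such sums is in P for quadratics and #P-hard from degree
3. DELTA (new-combination → new theorem): nobody combines (E) at p = 2, exponent ≥ 2, with the COUNT
'critical points = skeleton trajectories, injective in the first variable  [refs: 10.1006/jnth.2002.2790, 10.4064/aa-80-1-1-48, 10.26421/qic13.11-12-7, 10.1007/s00220-022-04320-1, 10.1007/978-3-642-14553-7_16, 1201.4867, 1810.03622, 1005.2632, arxiv:1201.4867, arxiv:1810.03622, doi:10.1006/jnth.2002.2790, doi:10.4064/aa-80-1-1-48, doi:10.26421/qic13.11-12-7, doi:10.1007/s00220-022-04320-1, doi:10.1007/978-3-642-14553-7_16, Fisher2002, DabrowskiFisher1997, Vandennest2013, BuKoh2]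

Barriers (technique_class: simulation, dequantization, stationary-phase, p-adic sums): technique_class: simulation, dequantization, stationary-phase, p-adic exponential sums
Literature.Barriers.QuantumAdvantage.Relativization: EVADED in kind, as for Dequantize
(`Relativization.not_relativizes_collapse_shape` forbids only RELATIVIZING proofs of O ↦ BQP^O ⊆
BPP^O): the island consumes the explicit kick polynomials (their Taylor expansions mod 4^c) gate by
gate; an oracle gate has no polynomial phase and no gradient, so TspSignInPrBPP says nothing about
BQP^O, and the hypothesis TspSignHard is an explicit Karp reduction, not an oracle simulation.
Literature.Barriers.QuantumAdvantage.Algebrization: same verdict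
(`Algebrization.not_isAlgebrizingInclusion_bqp_bpp`): no arithmetization/low-degree extension of an
oracle is involved; the 'low degree' here is of the circuit's own phase polynomial over ℤ/4^c.
Literature.Barriers.QuantumAdvantage.SeparationPrerequisites: not engaged — the route proves no
separation; its target is the collapse side and its earned items are unconditional simulation
theorems about a sub-model.
Literature.Barriers.QuantumAdvantage.TotalFunctionSpeedupLimit: informative only — nothing
black-box; the island is a white-box structure theorem (the need for structure read backwards:
ring-polynomial structure at precision ≥ 2 digits is TOO MUCH structure).
Literature.Barriers.QuantumAdvantage.NaturalProofs,
Literature.Barriers.QuantumAdvantage.PPolyOracles: n/a (no circuit lower bound, no oracle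
separation).
Tree entries TensorNetworkContraction / Bo

History (route lifecycle, newest last):
- 2026-08-23T05:12:02Z · DORMANT — reconciler: no traction for 5.9 d (last activity statement-grounded at 2026-08-17T06:24:47Z); parked, not closed — `ledger route dormant route-QuantumAdvantage- (operator:999:3642298)

sub-problem: QuantumAdvantage · status: dormant · opened planner-plancard-QuantumAdvantage-QuantumAdva-7e3fe5c9-0 2026-08-15T11:06:38Z · rev 3 · ledger route-QuantumAdvantage-TwoAdicStationaryPhase
GENERATED by the gate from the ledger (D-0016/17). Provers cite these decls: `theorem foo : Summit.QuantumAdvantage.QuantumAdvantage.Theses.TwoAdicStationaryPhase.<Decl> := …` in Summits/QuantumAdvantage/QuantumAdvantage/Theorems/<Name>.lean.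
-/

namespace Summit.QuantumAdvantage.QuantumAdvantage.Theses.TwoAdicStationaryPhase

open scoped BigOperators Topology Manifold Classical MeasureTheory ProbabilityTheory Matrix InnerProductSpace ComplexConjugate ContinuousMap
open Filter Set Function TopologicalSpace MeasureTheory

attribute [summit_statement] _root_.QuantumAdvantage

open Literature.QuantumAdvantage

/-- item stmt-QuantumAdvantage-0242 · target · rank 0 · open · by planner
why it might fail: X = BQP ⊆ BPP puts FACTORING in BPP (Shor1997; tree FACT_mem_BQP_holds) against the oracle evidence BQP^O ⊄ BPP^O (BernsteinVazirani1997 §8; tree exists_oracle_BQPRel_not_subset_BPPRel_holds). This route reaches X only via TspSignHard, which its own island makes ≡ PromiseBQP ⊆ prBPP.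
sources: Shor1997, BernsteinVazirani1997, Literature.Computability.Cryptography.FACT_mem_BQP_holds, Literature.Computability.QuantumComplexity.exists_oracle_BQPRel_not_subset_BPPRel_holds, Vandennest2013, KociaLove2021
Thesis X of route Dequantize, targeting ¬QuantumAdvantage (quantum-advantage.S02, BQP = BPP): every
uniform Clifford+T family with error 1/3 is simulable in BPP. [BernsteinVazirani1997 §8;
BravyiGosset2016] -/
@[route_item "route-QuantumAdvantage-TwoAdicStationaryPhase"]
def TspThesis : Prop :=
  Literature.Computability.Cryptography.BQP ⊆ Literature.Computability.Complexity.BPP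

/-- item stmt-QuantumAdvantage-2646 · crux · rank 2 · open · by planner
why it might fail: Unpublished island, TRUE on paper modulo TspAmplitudeAverage (DF97 Thm 1.8(a) p.10: m = 2j, any prime; + Hénon count); as TYPED it can fail only in the PromiseBPP' plumbing: L' ∈ P over boolPair x coins, c UNARY (binary c ⇒ exponential 4^c-arithmetic), nested pairBool/listBool decoded in FP.
sources: DabrowskiFisher1997, Fisher2002, KociaLove2021, arXiv:1810.03622, Vandennest2013, BuKoh2022
[crux] ISLAND. POLYSIGN (one register): instance I = (c, x, y, P_0, [P_1..P_k]) with c in UNARY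
(Computability.unaryEncodingNat), x y : ℕ, kicks as coefficient lists of naturals (read in ℤ, then
mod 4^c); A(I) := (2^c)^{-(k+1)} Σ_{v : Fin k → ZMod (4^c)} e(Φ(v)/4^c), Φ(v) = Σ_{i=0}^{k} P_i(w_i)
+ w_i·w_{i+1}, w = (x, v_0..v_{k-1}, y), i.e. A = ⟨y| F·D_{P_k} ⋯ F·D_{P_0} |x⟩ (F = QFT_{4^c}, D_P
= e(P(t)/4^c)); YES: Re A ≥ 1/3, NO: Re A ≤ −1/3; built as `PromiseProblem.ofEncoding` of the
evident Bool encoding of ℕ × ℕ × ℕ × List ℕ × List (List ℕ). CLAIM: POLYSIGN ∈ PromiseBPP' (textbook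
promise-BPP). PROOF SKETCH (new): by TspAmplitudeAverage, A = 2^{-c} Σ_{a ∈ (ℤ/2^c)^k critical}
e(Φ(ã)/4^c) and a critical a is determined by a_0 through the Hénon recurrence a_{j+1} = −a_{j−1} −
P'_{j+1}(a_j) mod 2^c (a_{−1} := x; closing condition: the j = k−1 equation holds with w_{k+1} = y);
so A = E_{s ∈ ℤ/2^c}[f(s)], f(s) := [the chain from a_0 = s is critical]·e(Φ(ã(s))/4^c) ∈ {0} ∪
U(1), computable in poly(c, k, bits) time (integer arithmetic mod 4^c on least-residue lifts ã ∈
[0,2^c); the phase is well defined on critical points since Φ(ã + 2^c u) ≡ Φ(ã) + 2^c ∇Φ(ã)·u mod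
4^c). O(1) uniform sa -/
@[route_item "route-QuantumAdvantage-TwoAdicStationaryPhase", crux]
def TspSignInPrBPP : Prop :=
  (Literature.Computability.Complexity.PromiseProblem.ofEncoding (Computability.unaryEncodingNat.pairBool (Computability.encodingNatBool.pairBool (Computability.encodingNatBool.pairBool (Computability.encodingNatBool.listBool.pairBool Computability.encodingNatBool.listBool.listBool)))) {I : ℕ × ℕ × ℕ × List ℕ × List (List ℕ) | (1 : ℝ) / 3 ≤ ((((2 : ℂ) ^ I.1)⁻¹ ^ (I.2.2.2.2.length + 1) * (∑ v : Fin I.2.2.2.2.length → ZMod (4 ^ I.1), Complex.exp (2 * Real.pi * Complex.I * ((((∑ i : Fin (I.2.2.2.2.length + 1), ((((fun i : Fin (I.2.2.2.2.length + 1) => (∑ j ∈ Finset.range (((I.2.2.2.1 :: I.2.2.2.2).getD i.val [])).length, Polynomial.C (((((I.2.2.2.1 :: I.2.2.2.2).getD i.val [])).getD j 0 : ℕ) : ℤ) * Polynomial.X ^ j)) i).map (Int.castRingHom (ZMod (4 ^ I.1)))).eval ((Fin.cons (((I.2.1 : ℤ) : ℤ) : ZMod (4 ^ I.1)) (Fin.snoc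 v (((I.2.2.1 : ℤ) : ℤ) : ZMod (4 ^ I.1))) : Fin (I.2.2.2.2.length + 2) → ZMod (4 ^ I.1)) i.castSucc) + (Fin.cons (((I.2.1 : ℤ) : ℤ) : ZMod (4 ^ I.1)) (Fin.snoc v (((I.2.2.1 : ℤ) : ℤ) : ZMod (4 ^ I.1))) : Fin (I.2.2.2.2.length + 2) → ZMod (4 ^ I.1)) i.castSucc * (Fin.cons (((I.2.1 : ℤ) : ℤ) : ZMod (4 ^ I.1)) (Fin.snoc v (((I.2.2.1 : ℤ) : ℤ) : ZMod (4 ^ I.1))) : Fin (I.2.2.2.2.length + 2) → ZMod (4 ^ I.1)) i.succ))).val : ℂ) / (4 ^ I.1 : ℂ)))))).re} {I : ℕ × ℕ × ℕ × List ℕ × List (List ℕ) | ((((2 : ℂ) ^ I.1)⁻¹ ^ (I.2.2.2.2.length + 1) * (∑ v : Fin I.2.2.2.2.length → ZMod (4 ^ I.1), Complex.exp (2 * Real.pi * Complex.I * ((((∑ i : Fin (I.2.2.2.2.length + 1), ((((fun i : Fin (I.2.2.2.2.length + 1) => (∑ j ∈ Finset.range (((I.2.2.2.1 :: I.2.2.2.2).getD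 i.val [])).length, Polynomial.C (((((I.2.2.2.1 :: I.2.2.2.2).getD i.val [])).getD j 0 : ℕ) : ℤ) * Polynomial.X ^ j)) i).map (Int.castRingHom (ZMod (4 ^ I.1)))).eval ((Fin.cons (((I.2.1 : ℤ) : ℤ) : ZMod (4 ^ I.1)) (Fin.snoc v (((I.2.2.1 : ℤ) : ℤ) : ZMod (4 ^ I.1))) : Fin (I.2.2.2.2.length + 2) → ZMod (4 ^ I.1)) i.castSucc) + (Fin.cons (((I.2.1 : ℤ) : ℤ) : ZMod (4 ^ I.1)) (Fin.snoc v (((I.2.2.1 : ℤ) : ℤ) : ZMod (4 ^ I.1))) : Fin (I.2.2.2.2.length + 2) → ZMod (4 ^ I.1)) i.castSucc * (Fin.cons (((I.2.1 : ℤ) : ℤ) : ZMod (4 ^ I.1)) (Fin.snoc v (((I.2.2.1 : ℤ) : ℤ) : ZMod (4 ^ I.1))) : Fin (I.2.2.2.2.length + 2) → ZMod (4 ^ I.1)) i.succ))).val : ℂ) / (4 ^ I.1 : ℂ)))))).re ≤ -((1 : ℝ) / 3)}) ∈ Literature.Computability.Complexity.PromiseBPP'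

/-- item stmt-QuantumAdvantage-2648 · crux · rank 4 · open · by planner
why it might fail: Consensus-FALSE: island (2646) + Karp-closure of PromiseBPP' (PromiseProblem.mem_PromiseBPP'_of_polyTimeReducible_holds) give PromiseBQP ⊆ PromiseBPP', so FACTORING ∈ BPP (FACT_mem_BQP_holds) against BQP^O ⊄ BPP^O (BV97 §8); one-register polynomial words lack bit-level gates: no encoding.
sources: Shor1997, BernsteinVazirani1997, Watrous2009, GoldreichPromise2006, Vandennest2013, KociaLove2021
[crux] HARDNESS HYPOTHESIS (first horn of the card's fork C4, 'quantum Hénon is PromiseBQP-hard'):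
every Q ∈ PromiseBQP Karp-reduces (PromiseProblem.PolyTimeReducible) to POLYSIGN. POLYSIGN (one
register): instance I = (c, x, y, P_0, [P_1..P_k]) with c in UNARY (Computability.unaryEncodingNat),
x y : ℕ, kicks as coefficient lists of naturals (read in ℤ, then mod 4^c); A(I) := (2^c)^{-(k+1)}
Σ_{v : Fin k → ZMod (4^c)} e(Φ(v)/4^c), Φ(v) = Σ_{i=0}^{k} P_i(w_i) + w_i·w_{i+1}, w = (x,
v_0..v_{k-1}, y), i.e. A = ⟨y| F·D_{P_k} ⋯ F·D_{P_0} |x⟩ (F = QFT_{4^c}, D_P = e(P(t)/4^c)); YES: Re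
A ≥ 1/3, NO: Re A ≤ −1/3; built as `PromiseProblem.ofEncoding` of the evident Bool encoding of ℕ × ℕ
× ℕ × List ℕ × List (List ℕ). A priori natural: QFT_{2^n} layers, phases e(t³/4^c) beyond the
quadratic (normalizer) island, T-like phases e(t/4^c), and the 'cubic phase + Fourier = universal'
heuristic; the obstruction is that bit-level gates are not ring-polynomial over ℤ/4^c (x ↦ x ⊕ 2^i,
sub-register Hadamards and modular exponentiation are not model gates; Vandennest2013 p.20 for the
last). STATUS: hypothesis-type item consumed by the Assembly (D-0014 style); given TspSignInPrBPP it
is FALSE unless Prom -/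
@[route_item "route-QuantumAdvantage-TwoAdicStationaryPhase", crux]
def TspSignHard : Prop :=
  ∀ Q ∈ Literature.Computability.Cryptography.PromiseBQP, Q.PolyTimeReducible (Literature.Computability.Complexity.PromiseProblem.ofEncoding (Computability.unaryEncodingNat.pairBool (Computability.encodingNatBool.pairBool (Computability.encodingNatBool.pairBool (Computability.encodingNatBool.listBool.pairBool Computability.encodingNatBool.listBool.listBool)))) {I : ℕ × ℕ × ℕ × List ℕ × List (List ℕ) | (1 : ℝ) / 3 ≤ ((((2 : ℂ) ^ I.1)⁻¹ ^ (I.2.2.2.2.length + 1) * (∑ v : Fin I.2.2.2.2.length → ZMod (4 ^ I.1), Complex.exp (2 * Real.pi * Complex.I * ((((∑ i : Fin (I.2.2.2.2.length + 1), ((((fun i : Fin (I.2.2.2.2.length + 1) => (∑ j ∈ Finset.range (((I.2.2.2.1 :: I.2.2.2.2).getD i.val [])).length, Polynomial.C (((((I.2.2.2.1 :: I.2.2.2.2).getD i.val [])).getD j 0 : ℕ) : ℤ) * Polynomial.X ^ j)) i).map (Int.castRingHom (ZMod (4 ^ I.1)))).eval ((Fin.cons (((I.2.1 : ℤ) : ℤ)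 : ZMod (4 ^ I.1)) (Fin.snoc v (((I.2.2.1 : ℤ) : ℤ) : ZMod (4 ^ I.1))) : Fin (I.2.2.2.2.length + 2) → ZMod (4 ^ I.1)) i.castSucc) + (Fin.cons (((I.2.1 : ℤ) : ℤ) : ZMod (4 ^ I.1)) (Fin.snoc v (((I.2.2.1 : ℤ) : ℤ) : ZMod (4 ^ I.1))) : Fin (I.2.2.2.2.length + 2) → ZMod (4 ^ I.1)) i.castSucc * (Fin.cons (((I.2.1 : ℤ) : ℤ) : ZMod (4 ^ I.1)) (Fin.snoc v (((I.2.2.1 : ℤ) : ℤ) : ZMod (4 ^ I.1))) : Fin (I.2.2.2.2.length + 2) → ZMod (4 ^ I.1)) i.succ))).val : ℂ) / (4 ^ I.1 : ℂ)))))).re} {I : ℕ × ℕ × ℕ × List ℕ × List (List ℕ) | ((((2 : ℂ) ^ I.1)⁻¹ ^ (I.2.2.2.2.length + 1) * (∑ v : Fin I.2.2.2.2.length → ZMod (4 ^ I.1), Complex.exp (2 * Real.pi * Complex.I * ((((∑ i : Fin (I.2.2.2.2.length + 1), ((((fun i : Fin (I.2.2.2.2.length + 1) => (∑ j ∈ Finset.range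 (((I.2.2.2.1 :: I.2.2.2.2).getD i.val [])).length, Polynomial.C (((((I.2.2.2.1 :: I.2.2.2.2).getD i.val [])).getD j 0 : ℕ) : ℤ) * Polynomial.X ^ j)) i).map (Int.castRingHom (ZMod (4 ^ I.1)))).eval ((Fin.cons (((I.2.1 : ℤ) : ℤ) : ZMod (4 ^ I.1)) (Fin.snoc v (((I.2.2.1 : ℤ) : ℤ) : ZMod (4 ^ I.1))) : Fin (I.2.2.2.2.length + 2) → ZMod (4 ^ I.1)) i.castSucc) + (Fin.cons (((I.2.1 : ℤ) : ℤ) : ZMod (4 ^ I.1)) (Fin.snoc v (((I.2.2.1 : ℤ) : ℤ) : ZMod (4 ^ I.1))) : Fin (I.2.2.2.2.length + 2) → ZMod (4 ^ I.1)) i.castSucc * (Fin.cons (((I.2.1 : ℤ) : ℤ) : ZMod (4 ^ I.1)) (Fin.snoc v (((I.2.2.1 : ℤ) : ℤ) : ZMod (4 ^ I.1))) : Fin (I.2.2.2.2.length + 2) → ZMod (4 ^ I.1)) i.succ))).val : ℂ) / (4 ^ I.1 : ℂ)))))).re ≤ -((1 : ℝ) / 3)})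

/-- item stmt-QuantumAdvantage-2647 · support · rank 3 · open · by planner
why it might fail: Verified numerically only for c ≤ 3, k ≤ 6; as TYPED it must survive c = 0 (ZMod 1), k = 0, the boundary conventions (x in the j = 0 constraint, y in the last) and the ZMod.val lifts — a convention slip makes (i) false; (ii) needs a pinned by a_0 exactly mod 2^c.
sources: DabrowskiFisher1997, Fisher2002, KociaLove2021
[crux] THE LOAD-BEARING IDENTITY (pure Mathlib). For all c k, kicks P : Fin (k+1) → ℤ[t], x y : ℤ:
(i) (2^c)^{-(k+1)}·Σ_{v ∈ (ZMod 4^c)^k} e(Φ(v)/4^c) = (2^c)^{-1}·Σ_{a ∈ (ZMod 2^c)^k critical}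
e(Φ(ã)/4^c), where 'critical' = ∀ j<k, P'_{j+1}(a_j) + w_j + w_{j+2} = 0 in ZMod 2^c (w = (x, a, y)
reduced mod 2^c; this is ∇Φ(a) = 0, the 2-adic Hénon-skeleton orbit condition of the card) and ã =
least-residue lift; (ii) #critical ≤ 2^c. (i) is TspChainLocalisation divided by (2^c)^{k+1}; (ii)
follows from TspChainInjective. Numerically verified by brute force for c ≤ 3, k ≤ 6 (planner
scratch/check_odd_chain.py, check_all_y.py: 0 failures on ~10^3 amplitudes). Meaning: every
amplitude of a one-register polynomial quantum map is an exact AVERAGE over ℤ/2^c of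
unimodular-or-zero, efficiently computable terms — exact stationary phase absorbs all the
square-root cancellation; the general r-register form is TspMultiRegister. -/
@[route_item "route-QuantumAdvantage-TwoAdicStationaryPhase"]
def TspAmplitudeAverage : Prop :=
  ∀ (c k : ℕ) (P : Fin (k + 1) → Polynomial ℤ) (x y : ℤ), (((2 : ℂ) ^ c)⁻¹ ^ (k + 1) * (∑ v : Fin k → ZMod (4 ^ c), Complex.exp (2 * Real.pi * Complex.I * ((((∑ i : Fin (k + 1), (((P i).map (Int.castRingHom (ZMod (4 ^ c)))).eval ((Fin.cons ↑x (Fin.snoc v ↑y) : Fin (k + 2) → ZMod (4 ^ c)) i.castSucc) + (Fin.cons ↑x (Fin.snoc v ↑y) : Fin (k + 2) → ZMod (4 ^ c)) i.castSucc * (Fin.cons ↑x (Fin.snoc v ↑y) : Fin (k + 2) → ZMod (4 ^ c)) i.succ))).val : ℂ) / (4 ^ c : ℂ))))) = ((2 : ℂ) ^ c)⁻¹ * (∑ a : Fin k → ZMod (2 ^ c), if (∀ j : Fin k, ((Polynomial.derivative (P j.succ)).map (Int.castRingHom (ZMod (2 ^ c)))).eval ((Fin.cons ↑x (Fin.snoc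 a ↑y) : Fin (k + 2) → ZMod (2 ^ c)) j.castSucc.succ) + (Fin.cons ↑x (Fin.snoc a ↑y) : Fin (k + 2) → ZMod (2 ^ c)) j.castSucc.castSucc + (Fin.cons ↑x (Fin.snoc a ↑y) : Fin (k + 2) → ZMod (2 ^ c)) j.succ.succ = 0) then Complex.exp (2 * Real.pi * Complex.I * ((((∑ i : Fin (k + 1), (((P i).map (Int.castRingHom (ZMod (4 ^ c)))).eval ((Fin.cons ↑x (Fin.snoc (fun i => (((a i).val : ℕ) : ZMod (4 ^ c))) ↑y) : Fin (k + 2) → ZMod (4 ^ c)) i.castSucc) + (Fin.cons ↑x (Fin.snoc (fun i => (((a i).val : ℕ) : ZMod (4 ^ c))) ↑y) : Fin (k + 2) → ZMod (4 ^ c)) i.castSucc * (Fin.cons ↑x (Fin.snoc (fun i => (((a i).val : ℕ) : ZMod (4 ^ c))) ↑y) : Fin (k + 2) → ZMod (4 ^ c)) i.succ))).val : ℂ) / (4 ^ c : ℂ))) else 0) ∧ (Finset.univ.filter (fun a : Fin k → ZMod (2 ^ c) => (∀ j : Fin k, ((Polynomial.derivative (P j.succ)).map (Int.castRingHom (ZMod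 (2 ^ c)))).eval ((Fin.cons ↑x (Fin.snoc a ↑y) : Fin (k + 2) → ZMod (2 ^ c)) j.castSucc.succ) + (Fin.cons ↑x (Fin.snoc a ↑y) : Fin (k + 2) → ZMod (2 ^ c)) j.castSucc.castSucc + (Fin.cons ↑x (Fin.snoc a ↑y) : Fin (k + 2) → ZMod (2 ^ c)) j.succ.succ = 0))).card ≤ 2 ^ c

/-- item stmt-QuantumAdvantage-2649 · support · rank 5 · open · by planner
why it might fail: ±1-valuedness of the summands needs c ≥ 1 (cubic Hasse terms carry 2^{3c} ≡ 0 mod 2^{2c+1}); the rank ≥ k−1 claim is for the pure path form (univariate kicks); only c ∈ {1,2}, k ≤ 4 checked numerically.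
sources: DabrowskiFisher1997, Fisher2002, KociaLove2021
[crux] ODD EXPONENT (register ℤ/2^{2c+1} = ZMod (2·4^c)): the Gauss factor is bounded. For c ≥ 1 and
a critical a ∈ (ZMod 2^c)^k (same criticality predicate mod 2^c), G(ã) := Σ_{u ∈ {0,1}^k} e((Φ(ã +
2^c u) − Φ(ã))/2^{2c+1}) has |G(ã)| ≤ 2^{(k+1)/2}. WHY (one register): the summands are ±1, namely
(−1)^{g·u + Q(u)} with 2^c g = ∇Φ(ã) and Q the second-order Hasse term mod 2 (cubic terms carry
2^{3c} ≡ 0 mod 2^{2c+1} for c ≥ 1); over 𝔽₂ the diagonal of Q is linear (u_i² = u_i), so the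
alternating part of Q is exactly the PATH adjacency from the w_i w_{i+1} terms (kicks are
univariate), of rank k or k−1, whence |G| ∈ {0, 2^{k − rank/2}} ≤ 2^{(k+1)/2}. With TspOddModulus: A
= 2^{-c-(k+1)/2} Σ_{critical} e(Φ(ã)/N)·G(ã), again a bounded average ⇒ the island at odd register
size too. Verified numerically (c ∈ {1,2}, k ≤ 4: scratch/check_odd_chain.py; for 2–3 registers with
cross kicks at n = 3 the normalised summand stayed ≤ 1: scratch/check_odd.py). For r ≥ 2 registers
the alternating form gains cross-kick entries; its corank versus r' is the open point
(TspMultiRegister's odd case). -/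
@[route_item "route-QuantumAdvantage-TwoAdicStationaryPhase"]
def TspOddGaussBound : Prop :=
  ∀ (c k : ℕ) (P : Fin (k + 1) → Polynomial ℤ) (x y : ℤ), 1 ≤ c → ∀ a : Fin k → ZMod (2 ^ c), (∀ j : Fin k, ((Polynomial.derivative (P j.succ)).map (Int.castRingHom (ZMod (2 ^ c)))).eval ((Fin.cons ↑x (Fin.snoc a ↑y) : Fin (k + 2) → ZMod (2 ^ c)) j.castSucc.succ) + (Fin.cons ↑x (Fin.snoc a ↑y) : Fin (k + 2) → ZMod (2 ^ c)) j.castSucc.castSucc + (Fin.cons ↑x (Fin.snoc a ↑y) : Fin (k + 2) → ZMod (2 ^ c)) j.succ.succ = 0) → ‖(∑ u : Fin k → Fin 2, Complex.exp (2 * Real.pi * Complex.I * ((((∑ i : Fin (k + 1), (((P i).map (Int.castRingHom (ZMod (2 * 4 ^ c)))).eval ((Fin.cons ↑x (Fin.snoc (fun i => (((a i).val + 2 ^ c * (u i).val : ℕ) : ZMod (2 * 4 ^ c))) ↑y) : Fin (k + 2) → ZMod (2 * 4 ^ c)) i.castSucc) + (Fin.cons ↑x (Fin.snoc (fun i =>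 (((a i).val + 2 ^ c * (u i).val : ℕ) : ZMod (2 * 4 ^ c))) ↑y) : Fin (k + 2) → ZMod (2 * 4 ^ c)) i.castSucc * (Fin.cons ↑x (Fin.snoc (fun i => (((a i).val + 2 ^ c * (u i).val : ℕ) : ZMod (2 * 4 ^ c))) ↑y) : Fin (k + 2) → ZMod (2 * 4 ^ c)) i.succ)) - (∑ i : Fin (k + 1), (((P i).map (Int.castRingHom (ZMod (2 * 4 ^ c)))).eval ((Fin.cons ↑x (Fin.snoc (fun i => (((a i).val : ℕ) : ZMod (2 * 4 ^ c))) ↑y) : Fin (k + 2) → ZMod (2 * 4 ^ c)) i.castSucc) + (Fin.cons ↑x (Fin.snoc (fun i => (((a i).val : ℕ) : ZMod (2 * 4 ^ c))) ↑y) : Fin (k + 2) → ZMod (2 * 4 ^ c)) i.castSucc * (Fin.cons ↑x (Fin.snoc (fun i => (((a i).val : ℕ) : ZMod (2 * 4 ^ c))) ↑y) : Fin (k + 2) → ZMod (2 * 4 ^ c)) i.succ))).val : ℂ) / (2 * 4 ^ c : ℂ))))‖ ≤ Real.sqrt 2 ^ (k + 1)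

-- item stmt-QuantumAdvantage-2727 · support · rank 6 · open · by planner — informal only, no Lean statement yet:
--   [crux] MULTI-REGISTER ISLAND IDENTITY (informal until the definition `PolyPhaseCircuit` lands; then
--   restate with a signature). Let c ≥ 0, r ≥ 1, and C a gate list over r registers ℤ/4^c, each gate
--   either F_j = QFT_{4^c} on register j (kernel ⟨u'|F_j|u⟩ = 2^{-c} e(u_j u'_j/4^c)·[u'_i = u_i, i ≠
--   j]) or a kick D_P, P ∈ ℤ[x_1..x_r] (diagonal phase e(P(u)/4^c)). Path sum: ⟨y|C|x⟩ = 2^{-c·#F} Σ_{v}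
--   e(Φ(v)/4^c) over one variable v ∈ ℤ/4^c per QFT that is not the last QFT on its register (K = #F −
--   r' variables, r' = number of registers hit by ≥ 1 QFT; registers never hit must satisfy x_j = y_j),
--   Φ = Σ

/-- item stmt-QuantumAdvantage-2650 · support · rank 7 · open · by planner
sources: DabrowskiFisher1997, Fisher2002, KociaLove2021
[support] EXACT 2-ADIC STATIONARY PHASE for chains = Fisher's periodized stationary phase
(DabrowskiFisher1997, Fisher2002; KociaLove2021 §5 Lemma 1 + Thm 1(a,b), stated there for odd p) at
p = 2, exponent m = 2c, j = c, where no ε-correction is needed. For all c k P x y: Σ_{v ∈ (ZMod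
4^c)^k} e(Φ(v)/4^c) = (2^c)^k · Σ_{a ∈ (ZMod 2^c)^k} [critical a]·e(Φ(ã)/4^c), ã = least-residue
lift. PROOF (10 lines): v ranges over (ZMod 4^c)^k exactly once as v = ã + 2^c u with a ∈ (ZMod
2^c)^k (lifted to [0,2^c)) and u ∈ (ℤ/2^c)^k; Taylor with integral Hasse derivatives: Φ(ã + 2^c u) ≡
Φ(ã) + 2^c ∇Φ(ã)·u (mod 4^c), since 2^{2c} kills every term of order ≥ 2; the u-sum factors into
complete character sums Σ_{u_j mod 2^c} e(∂_jΦ(ã) u_j / 2^c) = 2^c·[∂_jΦ(ã) ≡ 0 mod 2^c]; and ∂_jΦ =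
P'_{j+1}(w_{j+1}) + w_j + w_{j+2} for Φ = Σ_i P_i(w_i) + w_i w_{i+1}. The same Taylor step shows
e(Φ(ã)/4^c) is independent of the lift on critical points, which is why the typed statement may use
`ZMod.val` lifts. -/
@[route_item "route-QuantumAdvantage-TwoAdicStationaryPhase"]
def TspChainLocalisation : Prop :=
  ∀ (c k : ℕ) (P : Fin (k + 1) → Polynomial ℤ) (x y : ℤ), (∑ v : Fin k → ZMod (4 ^ c), Complex.exp (2 * Real.pi * Complex.I * ((((∑ i : Fin (k + 1), (((P i).map (Int.castRingHom (ZMod (4 ^ c)))).eval ((Fin.cons ↑x (Fin.snoc v ↑y) : Fin (k + 2) → ZMod (4 ^ c)) i.castSucc) + (Fin.cons ↑x (Fin.snoc v ↑y) : Fin (k + 2) → ZMod (4 ^ c)) i.castSucc * (Fin.cons ↑x (Fin.snoc v ↑y) : Fin (k + 2) → ZMod (4 ^ c)) i.succ))).val : ℂ) / (4 ^ c : ℂ)))) = (2 ^ c : ℂ) ^ k * (∑ a : Fin k → ZMod (2 ^ c), if (∀ j : Fin k, ((Polynomial.derivative (P j.succ)).map (Int.castRingHom (ZMod (2 ^ c)))).eval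 ((Fin.cons ↑x (Fin.snoc a ↑y) : Fin (k + 2) → ZMod (2 ^ c)) j.castSucc.succ) + (Fin.cons ↑x (Fin.snoc a ↑y) : Fin (k + 2) → ZMod (2 ^ c)) j.castSucc.castSucc + (Fin.cons ↑x (Fin.snoc a ↑y) : Fin (k + 2) → ZMod (2 ^ c)) j.succ.succ = 0) then Complex.exp (2 * Real.pi * Complex.I * ((((∑ i : Fin (k + 1), (((P i).map (Int.castRingHom (ZMod (4 ^ c)))).eval ((Fin.cons ↑x (Fin.snoc (fun i => (((a i).val : ℕ) : ZMod (4 ^ c))) ↑y) : Fin (k + 2) → ZMod (4 ^ c)) i.castSucc) + (Fin.cons ↑x (Fin.snoc (fun i => (((a i).val : ℕ) : ZMod (4 ^ c))) ↑y) : Fin (k + 2) → ZMod (4 ^ c)) i.castSucc * (Fin.cons ↑x (Fin.snoc (fun i => (((a i).val : ℕ) : ZMod (4 ^ c))) ↑y) : Fin (k + 2) → ZMod (4 ^ c)) i.succ))).val : ℂ) / (4 ^ c : ℂ))) else 0)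

/-- item stmt-QuantumAdvantage-2651 · support · rank 8 · open · by planner
sources: KociaLove2021, DabrowskiFisher1997
[support] CRITICAL POINTS ARE SKELETON TRAJECTORIES (the card's (T)): two critical a, b ∈ (ZMod
2^c)^k with a_0 = b_0 coincide — the j-th criticality equation P'_{j+1}(a_j) + w_j + w_{j+2} = 0
determines w_{j+2} = a_{j+1} from (a_{j−1}, a_j) (generalised Hénon map h(u,v) = (v, −u − P'(v)),
Jacobian 1 — Friedland–Milnor's building block); induction on j. Gives #critical ≤ 2^c and the
sampler's parametrisation by s = a_0. -/
@[route_item "route-QuantumAdvantage-TwoAdicStationaryPhase"]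
def TspChainInjective : Prop :=
  ∀ (c k : ℕ) (P : Fin (k + 1) → Polynomial ℤ) (x y : ℤ), ∀ a b : Fin k → ZMod (2 ^ c), (∀ j : Fin k, ((Polynomial.derivative (P j.succ)).map (Int.castRingHom (ZMod (2 ^ c)))).eval ((Fin.cons ↑x (Fin.snoc a ↑y) : Fin (k + 2) → ZMod (2 ^ c)) j.castSucc.succ) + (Fin.cons ↑x (Fin.snoc a ↑y) : Fin (k + 2) → ZMod (2 ^ c)) j.castSucc.castSucc + (Fin.cons ↑x (Fin.snoc a ↑y) : Fin (k + 2) → ZMod (2 ^ c)) j.succ.succ = 0) → (∀ j : Fin k, ((Polynomial.derivative (P j.succ)).map (Int.castRingHom (ZMod (2 ^ c)))).eval ((Fin.cons ↑x (Fin.snoc b ↑y) : Fin (k + 2) → ZMod (2 ^ c)) j.castSucc.succ) + (Fin.cons ↑x (Fin.snoc b ↑y) : Fin (k + 2) → ZMod (2 ^ c)) j.castSucc.castSucc + (Fin.cons ↑x (Fin.snoc b ↑y) : Fin (k + 2) → ZMod (2 ^ c)) j.succ.succ = 0) → (∀ i : Fin k, i.val = 0 → a i = b i) → a = b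

/-- item stmt-QuantumAdvantage-2652 · support · rank 9 · open · by planner
sources: Fisher2002, KociaLove2021, DabrowskiFisher1997
[support] ODD-EXPONENT LOCALISATION (Fisher2002 / KociaLove2021 Thm 1(b) with m − 2j = 1, at p = 2):
over ZMod (2·4^c), Σ_v e(Φ(v)/(2·4^c)) = (2^c)^k Σ_{a ∈ (ZMod 2^c)^k} [critical a mod
2^c]·e(Φ(ã)/(2·4^c))·G(ã), with G(ã) = Σ_{u ∈ {0,1}^k} e((Φ(ã + 2^c u) − Φ(ã))/(2·4^c)). PROOF: v =
ã + 2^c u with u ∈ ℤ/2^{c+1}; split u = u_0 + 2u_1, u_0 ∈ {0,1}^k, u_1 mod 2^c; Taylor to second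
order (third-order terms carry 2^{3c} ≡ 0 mod 2^{2c+1} for c ≥ 1; c = 0 is the trivial identity);
the u_1-sum is complete and localises onto ∇Φ(ã) ≡ 0 mod 2^c; the u_0-sum is G. Verified numerically
(c ∈ {1,2}, k ≤ 4). With TspOddGaussBound: the island at odd register sizes. -/
@[route_item "route-QuantumAdvantage-TwoAdicStationaryPhase"]
def TspOddModulus : Prop :=
  ∀ (c k : ℕ) (P : Fin (k + 1) → Polynomial ℤ) (x y : ℤ), (∑ v : Fin k → ZMod (2 * 4 ^ c), Complex.exp (2 * Real.pi * Complex.I * ((((∑ i : Fin (k + 1), (((P i).map (Int.castRingHom (ZMod (2 * 4 ^ c)))).eval ((Fin.cons ↑x (Fin.snoc v ↑y) : Fin (k + 2) → ZMod (2 * 4 ^ c)) i.castSucc) + (Fin.cons ↑x (Fin.snoc v ↑y) : Fin (k + 2) → ZMod (2 * 4 ^ c)) i.castSucc * (Fin.cons ↑x (Fin.snoc v ↑y) : Fin (k + 2) → ZMod (2 * 4 ^ c)) i.succ))).val : ℂ) / (2 * 4 ^ c : ℂ)))) = (2 ^ c : ℂ) ^ k * (∑ a : Fin k → ZMod (2 ^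 c), if (∀ j : Fin k, ((Polynomial.derivative (P j.succ)).map (Int.castRingHom (ZMod (2 ^ c)))).eval ((Fin.cons ↑x (Fin.snoc a ↑y) : Fin (k + 2) → ZMod (2 ^ c)) j.castSucc.succ) + (Fin.cons ↑x (Fin.snoc a ↑y) : Fin (k + 2) → ZMod (2 ^ c)) j.castSucc.castSucc + (Fin.cons ↑x (Fin.snoc a ↑y) : Fin (k + 2) → ZMod (2 ^ c)) j.succ.succ = 0) then Complex.exp (2 * Real.pi * Complex.I * ((((∑ i : Fin (k + 1), (((P i).map (Int.castRingHom (ZMod (2 * 4 ^ c)))).eval ((Fin.cons ↑x (Fin.snoc (fun i => (((a i).val : ℕ) : ZMod (2 * 4 ^ c))) ↑y) : Fin (k + 2) → ZMod (2 * 4 ^ c)) i.castSucc) + (Fin.cons ↑x (Fin.snoc (fun i => (((a i).val : ℕ) : ZMod (2 * 4 ^ c))) ↑y) : Fin (k + 2) → ZMod (2 * 4 ^ c)) i.castSucc * (Fin.cons ↑x (Fin.snoc (fun i => (((a i).val : ℕ) : ZMod (2 * 4 ^ c))) ↑y) : Fin (k + 2) → ZMod (2 * 4 ^ c)) i.succ))).val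 : ℂ) / (2 * 4 ^ c : ℂ))) * (∑ u : Fin k → Fin 2, Complex.exp (2 * Real.pi * Complex.I * ((((∑ i : Fin (k + 1), (((P i).map (Int.castRingHom (ZMod (2 * 4 ^ c)))).eval ((Fin.cons ↑x (Fin.snoc (fun i => (((a i).val + 2 ^ c * (u i).val : ℕ) : ZMod (2 * 4 ^ c))) ↑y) : Fin (k + 2) → ZMod (2 * 4 ^ c)) i.castSucc) + (Fin.cons ↑x (Fin.snoc (fun i => (((a i).val + 2 ^ c * (u i).val : ℕ) : ZMod (2 * 4 ^ c))) ↑y) : Fin (k + 2) → ZMod (2 * 4 ^ c)) i.castSucc * (Fin.cons ↑x (Fin.snoc (fun i => (((a i).val + 2 ^ c * (u i).val : ℕ) : ZMod (2 * 4 ^ c))) ↑y) : Fin (k + 2) → ZMod (2 * 4 ^ c)) i.succ)) - (∑ i : Fin (k + 1), (((P i).map (Int.castRingHom (ZMod (2 * 4 ^ c)))).eval ((Fin.cons ↑x (Fin.snoc (fun i => (((a i).val : ℕ) : ZMod (2 * 4 ^ c))) ↑y) : Fin (k + 2) → ZMod (2 * 4 ^ c)) i.castSucc) + (Fin.cons ↑x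 (Fin.snoc (fun i => (((a i).val : ℕ) : ZMod (2 * 4 ^ c))) ↑y) : Fin (k + 2) → ZMod (2 * 4 ^ c)) i.castSucc * (Fin.cons ↑x (Fin.snoc (fun i => (((a i).val : ℕ) : ZMod (2 * 4 ^ c))) ↑y) : Fin (k + 2) → ZMod (2 * 4 ^ c)) i.succ))).val : ℂ) / (2 * 4 ^ c : ℂ)))) else 0)

-- item stmt-QuantumAdvantage-2776 · support · rank 10 · open · by planner — informal only, no Lean statement yet:
--   [support] DECISION-CLASS COROLLARY (the island headline; informal until `PolyPhaseCircuit` lands).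
--   Let PQM(c, r) be the languages L ⊆ {0,1}* for which some poly-time computable map w ↦ (C_w, x_w)
--   (C_w an r(|w|)-register PolyPhaseCircuit over ℤ/4^{c(|w|)}, c in unary, x_w an input basis state)
--   decides L with gap (2/3, 1/3) under the readout 'measure register 0, output its least significant
--   bit'. CLAIM: PQM ⊆ BPP (for every polynomially bounded c, r, circuit size, kick degree and
--   coefficient length). PROOF FROM TspMultiRegister (resp. TspAmplitudeAverage for r = 1): the
--   acceptance bias Pr[lsb =

/-- item stmt-QuantumAdvantage-2653 · assembly · rank 1 · open · by planner
sources: GoldreichPromise2006, Watrous2009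
[assembly] TspSignInPrBPP → TspSignHard → ¬QuantumAdvantage. Proof (≤ 10 lines once both decls
exist): hardness + `Literature.Computability.Complexity.mem_PromiseBPP'_of_polyTimeReducible_holds`
(closure of PromiseBPP' under Karp reductions; PromiseBPPClosureProofs.lean) put every Q ∈
PromiseBQP in PromiseBPP'; for the summit's witness L ∈ BQP ∖ BPP, `ofLanguage_mem_PromiseBQP_iff`
gives ofLanguage L ∈ PromiseBQP ⊆ PromiseBPP', and `ofLanguage_mem_PromiseBPP'_iff` gives L ∈ BPP —
contradiction. (Equivalently the two cruxes give TspThesis = BQP ⊆ BPP.) -/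
@[route_item "route-QuantumAdvantage-TwoAdicStationaryPhase"]
def Assembly : Prop :=
  TspSignInPrBPP → TspSignHard → ¬ QuantumAdvantage

/-! D-0027 §2.1 — DECIDING THEOREM (planner-authored via `route open/edit --closes-file`; by planner-rbadge-QuantumAdvantage-TwoAdicStation-9a1a1053-g2-0 2026-08-15T16:10:41Z):
its hypotheses are this route's items and its conclusion the sub-problem Statement (glue_lint), and it elaborates with this file. -/

@[closes "route-QuantumAdvantage-TwoAdicStationaryPhase"] theorem closes (h₁ : TspSignInPrBPP) (h₂ : TspSignHard) : ¬ QuantumAdvantage := by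
  rintro ⟨L, hL, hLn⟩
  exact hLn (Literature.Computability.Complexity.ofLanguage_mem_PromiseBPP'_iff.1
    (Literature.Computability.Complexity.PromiseProblem.mem_PromiseBPP'_of_polyTimeReducible_holds'
      (h₂ _ (Literature.Computability.Cryptography.ofLanguage_mem_PromiseBQP_iff.2 hL)) h₁))

end Summit.QuantumAdvantage.QuantumAdvantage.Theses.TwoAdicStationaryPhase
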